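import Mathlib.Analysis.SpecialFunctions.Pow.Real
import Mathlib.Analysis.SpecialFunctions.Sqrt

/-!
# The fourth-order strong-coupling couplings of the one-band Hubbard model and the exact `(J, J_c) ↔ (t, U)` dictionary behind the «t–U fits» of cuprate magnon dispersions

At half filling and to order `t⁴/U³` the square-lattice one-band Hubbard model (nearest-neighbour
hopping `t`, on-site `U`) maps onto the spin Hamiltonian with nearest-, second-, third-neighbour
Heisenberg couplings and a four-spin ring (cyclic) exchange,
`J = 4t²/U − 24t⁴/U³`, `J′ = J″ = 4t⁴/U³`, `J_c = 80t⁴/U³`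
[Takahashi1977; MacdonaldGirvinYoshioka1988], as restated in [ColdeaEtAl2001, p. 3],
[DelannoyEtAl2005, Eq. (11)], [DelannoyEtAl2009, Eq. (16)], [PengEtAl2017, p. 5].  Inelastic-neutron
and RIXS magnon dispersions of cuprate parents are FITTED with these expressions («t–U fit»), and
the resulting `(t, U)` pairs are the experiment-derived one-band `U` values quoted for La₂CuO₄
(`t = 0.30(2) eV, U = 2.2(4) eV` at 10 K; `0.33(2), 2.9(4)` at 295 K [ColdeaEtAl2001, p. 3];
`J = 143(2), J′ = J″ = 2.9(2), J_c = 58(4) meV` [HeadingsEtAl2010, p. 3]) and for Bi2201, NdBa₂Cu₃O₆,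
CaCuO₂ [PengEtAl2017, Table 1].

This file contains NO claim about the Hubbard model itself (the perturbative derivation is not
formalised): the printed coupling polynomials are DEFINITIONS (`scJ1`, `scJ2`, `scJc`), and the
theorems are the exact algebra every user of the fit performs:

* §1 the printed relations `J′ = J″ = J_c/20` and the cancellation `10J + 3J_c = 40t²/U`
  (the `t⁴` terms drop out: `J + (3/10)J_c` is the bare second-order superexchange `4t²/U`);
* §2 the CLOSED-FORM INVERSION `U = (10J + 3J_c)²/(20J_c)`, `t² = (10J + 3J_c)³/(800J_c)`,
  `(U/t)² = 6 + 20J/J_c` (`tUfitU`, `tUfitTsq`, `tUfitT`, `tUfitUOverT`): it is a two-sided inverse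
  of `(t, U) ↦ (J, J_c)` on `t > 0, U ≠ 0` ↔ `J_c > 0, 10J + 3J_c > 0`, hence the fit has exactly one
  solution and `U/t` depends on the ratio `J/J_c` alone; it reproduces every printed `(t, U)` column
  from the printed `(J, J_c)` (§5);
* §3 MONOTONICITY: `U` is increasing in `J` and decreasing in `J_c` while `3J_c ≤ 10J`, `(U/t)²` is
  increasing in `J`, decreasing in `J_c`, `t²` is increasing in `J` and decreasing in `J_c` while
  `3J_c ≤ 5J` — so a box of error bars on `(J, J_c)` maps to an interval with the stated corners
  (`tUfitU_mem_Icc_of_box`, …): the propagation of INDEPENDENT error bars, which need not coincide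
  with a printed (correlated) least-squares bar — §4: Coldea's printed bars give `U ∈ [2.38, 3.82] eV`
  at 295 K (printed `2.9 ± 0.4`) and `[1.92, 2.61] eV` at 10 K (printed `2.2 ± 0.4`);
* §4 worked instances against the printed tables (exact rational arithmetic): the formulas return
  Coldea's, Headings' and Peng's `(t, U)` columns from their `(J, J_c)` columns to the printed digit.

The linear-spin-wave zone-boundary identities that accompany the fits (`E_max = 2Z_c(J − J_c/10)`,
`ΔE_MBZB = (3/5)Z_cJ_c` [PengEtAl2017, Eqs. (1)–(2)]) are in the companion file
`HubbardRingExchangeSpinWaves.lean`.  Not here: the `t′, t″` generalisation (many more couplings: [DelannoyEtAl2009, §II.C, App. B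
tables]) — `TODO(general form)`; the `1/S` renormalisation `Z_c` is a parameter, never evaluated;
nothing about which `U` «school» such fits belong to (they are experiment-calibrated CONTEXT values
in the cell's tables, not ab initio ones).

References: M. Takahashi, J. Phys. C 10 (1977) 1289; A. H. MacDonald, S. M. Girvin, D. Yoshioka,
Phys. Rev. B 37 (1988) 9753; R. Coldea, S. M. Hayden, G. Aeppli, T. G. Perring, C. D. Frost,
T. E. Mason, S.-W. Cheong, Z. Fisk, Phys. Rev. Lett. 86 (2001) 5377, arXiv:cond-mat/0006384;
J.-Y. P. Delannoy, M. J. P. Gingras, P. C. W. Holdsworth, A.-M. S. Tremblay, Phys. Rev. B 72 (2005)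
115114, arXiv:cond-mat/0412033, and Phys. Rev. B 79 (2009) 235130, arXiv:0808.3167; N. S. Headings,
S. M. Hayden, R. Coldea, T. G. Perring, Phys. Rev. Lett. 105 (2010) 247001, arXiv:1009.2915;
Y. Y. Peng et al., Nature Phys. 13 (2017) 1201, arXiv:1609.05405.
AI-produced formalisation (H21, cell hubbard-downfold, seat lit-2, 2026-08-27); no facts, no
axioms beyond Mathlib's, no `sorry`.
-/

namespace Literature.MathematicalPhysics.QuantumLattice

open Real Set

noncomputable section

/-! ## 1. The printed fourth-order couplings -/

/-- Nearest-neighbour exchange of the half-filled one-band Hubbard model to order `t⁴/U³`: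
`J = 4t²/U − 24t⁴/U³`. [cite: ColdeaEtAl2001, p. 3 (restating MacdonaldGirvinYoshioka1988, Takahashi1977)] -/
def scJ1 (t U : ℝ) : ℝ := 4 * t ^ 2 / U - 24 * t ^ 4 / U ^ 3

/-- Second- and third-neighbour exchange to order `t⁴/U³`: `J′ = J″ = 4t⁴/U³` (one definition
serves both). [cite: ColdeaEtAl2001, p. 3 (restating MacdonaldGirvinYoshioka1988, Takahashi1977)] -/
def scJ2 (t U : ℝ) : ℝ := 4 * t ^ 4 / U ^ 3

/-- Four-spin ring (cyclic) exchange to order `t⁴/U³`: `J_c = 80t⁴/U³`.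
[cite: ColdeaEtAl2001, p. 3 (restating MacdonaldGirvinYoshioka1988, Takahashi1977)] -/
def scJc (t U : ℝ) : ℝ := 80 * t ^ 4 / U ^ 3

/-- Unfolding. [cite: ColdeaEtAl2001, p. 3] -/
theorem scJ1_def (t U : ℝ) : scJ1 t U = 4 * t ^ 2 / U - 24 * t ^ 4 / U ^ 3 := rfl

/-- Unfolding. [cite: ColdeaEtAl2001, p. 3] -/
theorem scJ2_def (t U : ℝ) : scJ2 t U = 4 * t ^ 4 / U ^ 3 := rfl

/-- Unfolding. [cite: ColdeaEtAl2001, p. 3] -/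
theorem scJc_def (t U : ℝ) : scJc t U = 80 * t ^ 4 / U ^ 3 := rfl

/-- The printed one-parameter constraint `J′ = J″ = J_c/20` (Coldea et al.: «J′ = J″ = J_c/20»;
Headings et al. print `J_c = 58(4)`, `J′ = J″ = 2.9(2) = 58/20` meV). [cite: ColdeaEtAl2001, p. 3] -/
theorem scJ2_eq_scJc_div (t U : ℝ) : scJ2 t U = scJc t U / 20 := by
  unfold scJ2 scJc; ring

/-- `J = 4t²/U − 6J′`. [cite: ColdeaEtAl2001, p. 3] -/
theorem scJ1_eq_sub_scJ2 (t U : ℝ) : scJ1 t U = 4 * t ^ 2 / U - 6 * scJ2 t U := by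
  unfold scJ1 scJ2; ring

/-- **The cancellation behind the fit**: `10J + 3J_c = 40t²/U` — the `t⁴/U³` terms drop out.
[cite: ColdeaEtAl2001, p. 3] -/
theorem ten_scJ1_add_three_scJc (t U : ℝ) : 10 * scJ1 t U + 3 * scJc t U = 40 * t ^ 2 / U := by
  unfold scJ1 scJc; ring

/-- Equivalently `J + (3/10)J_c = 4t²/U`, the bare second-order superexchange (the quantity
`superexchangeJ t U` of `FiniteTemperatureStripeOnset.lean`, not imported here).
[cite: ColdeaEtAl2001, p. 3] -/
theorem scJ1_add_scJc (t U : ℝ) : scJ1 t U + 3 / 10 * scJc t U = 4 * t ^ 2 / U := by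
  unfold scJ1 scJc; ring

/-- Factorised form `J = 4t²(U² − 6t²)/U³`. [cite: ColdeaEtAl2001, p. 3] -/
theorem scJ1_eq_factor {t U : ℝ} (hU : U ≠ 0) :
    scJ1 t U = 4 * t ^ 2 * (U ^ 2 - 6 * t ^ 2) / U ^ 3 := by
  unfold scJ1; field_simp; ring

/-- `J_c > 0` for `U > 0`, `t ≠ 0`. [cite: ColdeaEtAl2001, p. 3] -/
theorem scJc_pos {t U : ℝ} (ht : t ≠ 0) (hU : 0 < U) : 0 < scJc t U := by
  unfold scJc; positivity

/-- `J > 0 ↔ 6t² < U²` (for `U > 0`, `t ≠ 0`): the fourth-order nearest-neighbour coupling is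
antiferromagnetic exactly when `U/|t| > √6`. [cite: ColdeaEtAl2001, p. 3] -/
theorem scJ1_pos_iff {t U : ℝ} (ht : t ≠ 0) (hU : 0 < U) : 0 < scJ1 t U ↔ 6 * t ^ 2 < U ^ 2 := by
  rw [scJ1_eq_factor hU.ne']
  have h4 : 0 < 4 * t ^ 2 := by positivity
  have hU3 : 0 < U ^ 3 := by positivity
  rw [div_pos_iff_of_pos_right hU3, mul_pos_iff_of_pos_left h4, sub_pos]

/-- The ratio of the two fitted couplings: `J/J_c = (U² − 6t²)/(20t²)`. [cite: ColdeaEtAl2001, p. 3] -/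
theorem scJ1_div_scJc {t U : ℝ} (ht : t ≠ 0) (hU : U ≠ 0) :
    scJ1 t U / scJc t U = (U ^ 2 - 6 * t ^ 2) / (20 * t ^ 2) := by
  unfold scJ1 scJc; field_simp; ring

/-- `(U/t)² = 6 + 20J/J_c`: the ratio `U/t` is fixed by `J/J_c` alone. [cite: ColdeaEtAl2001, p. 3] -/
theorem sq_U_div_t_eq {t U : ℝ} (ht : t ≠ 0) (hU : U ≠ 0) :
    (U / t) ^ 2 = 6 + 20 * (scJ1 t U / scJc t U) := by
  rw [scJ1_div_scJc ht hU]; field_simp; ring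

/-! ## 2. The closed-form inversion (the «t–U fit» solved exactly) -/

/-- `U` from the fitted couplings: `U = (10J + 3J_c)²/(20J_c)`. [cite: ColdeaEtAl2001, p. 3] -/
def tUfitU (J Jc : ℝ) : ℝ := (10 * J + 3 * Jc) ^ 2 / (20 * Jc)

/-- `t²` from the fitted couplings: `t² = (10J + 3J_c)³/(800J_c)`. [cite: ColdeaEtAl2001, p. 3] -/
def tUfitTsq (J Jc : ℝ) : ℝ := (10 * J + 3 * Jc) ^ 3 / (800 * Jc)

/-- `t = √((10J + 3J_c)³/(800J_c))` (the non-negative root). [cite: ColdeaEtAl2001, p. 3] -/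
def tUfitT (J Jc : ℝ) : ℝ := sqrt (tUfitTsq J Jc)

/-- `U/t = √(6 + 20J/J_c)`. [cite: ColdeaEtAl2001, p. 3] -/
def tUfitUOverT (J Jc : ℝ) : ℝ := sqrt (6 + 20 * J / Jc)

/-- Unfolding. [cite: ColdeaEtAl2001, p. 3] -/
theorem tUfitU_def (J Jc : ℝ) : tUfitU J Jc = (10 * J + 3 * Jc) ^ 2 / (20 * Jc) := rfl

/-- Unfolding. [cite: ColdeaEtAl2001, p. 3] -/
theorem tUfitTsq_def (J Jc : ℝ) : tUfitTsq J Jc = (10 * J + 3 * Jc) ^ 3 / (800 * Jc) := rfl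

/-- Unfolding. [cite: ColdeaEtAl2001, p. 3] -/
theorem tUfitT_def (J Jc : ℝ) : tUfitT J Jc = sqrt (tUfitTsq J Jc) := rfl

/-- Unfolding. [cite: ColdeaEtAl2001, p. 3] -/
theorem tUfitUOverT_def (J Jc : ℝ) : tUfitUOverT J Jc = sqrt (6 + 20 * J / Jc) := rfl

/-- Partial-fraction form `U = 5J²/J_c + 3J + 9J_c/20`. [cite: ColdeaEtAl2001, p. 3] -/
theorem tUfitU_eq_partialFraction {J Jc : ℝ} (hJc : Jc ≠ 0) :
    tUfitU J Jc = 5 * J ^ 2 / Jc + 3 * J + 9 * Jc / 20 := by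
  unfold tUfitU; field_simp; ring

/-- **Left inverse, `U`**: feeding the Hubbard couplings into the fit formula returns `U`
(`t ≠ 0`, `U ≠ 0`). [cite: ColdeaEtAl2001, p. 3] -/
theorem tUfitU_scJ {t U : ℝ} (ht : t ≠ 0) (hU : U ≠ 0) : tUfitU (scJ1 t U) (scJc t U) = U := by
  unfold tUfitU; rw [ten_scJ1_add_three_scJc]; unfold scJc; field_simp; ring

/-- **Left inverse, `t²`**. [cite: ColdeaEtAl2001, p. 3] -/
theorem tUfitTsq_scJ {t U : ℝ} (ht : t ≠ 0) (hU : U ≠ 0) :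
    tUfitTsq (scJ1 t U) (scJc t U) = t ^ 2 := by
  unfold tUfitTsq; rw [ten_scJ1_add_three_scJc]; unfold scJc; field_simp; ring

/-- **Left inverse, `t`** (the non-negative root). [cite: ColdeaEtAl2001, p. 3] -/
theorem tUfitT_scJ {t U : ℝ} (ht : 0 < t) (hU : U ≠ 0) : tUfitT (scJ1 t U) (scJc t U) = t := by
  unfold tUfitT; rw [tUfitTsq_scJ ht.ne' hU]; exact sqrt_sq ht.le

/-- **Left inverse, `U/t`** (for `U > 0`). [cite: ColdeaEtAl2001, p. 3] -/
theorem tUfitUOverT_scJ {t U : ℝ} (ht : 0 < t) (hU : 0 < U) :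
    tUfitUOverT (scJ1 t U) (scJc t U) = U / t := by
  unfold tUfitUOverT; rw [mul_div_assoc, ← sq_U_div_t_eq ht.ne' hU.ne']
  exact sqrt_sq (div_pos hU ht).le

/-- **Uniqueness of the fit**: two parameter pairs `(t, U)`, `(t′, U′)` with `t, t′ > 0`, `U, U′ ≠ 0`
and the same `(J, J_c)` coincide. [cite: ColdeaEtAl2001, p. 3] -/
theorem scJ_injective {t t' U U' : ℝ} (ht : 0 < t) (ht' : 0 < t') (hU : U ≠ 0) (hU' : U' ≠ 0)
    (hJ : scJ1 t U = scJ1 t' U') (hc : scJc t U = scJc t' U') : t = t' ∧ U = U' := by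
  refine ⟨?_, ?_⟩
  · rw [← tUfitT_scJ ht hU, ← tUfitT_scJ ht' hU', hJ, hc]
  · rw [← tUfitU_scJ ht.ne' hU, ← tUfitU_scJ ht'.ne' hU', hJ, hc]

/-- `t² ≥ 0` on the physical domain `J_c > 0`, `10J + 3J_c ≥ 0`. [cite: ColdeaEtAl2001, p. 3] -/
theorem tUfitTsq_nonneg {J Jc : ℝ} (hJc : 0 < Jc) (h : 0 ≤ 10 * J + 3 * Jc) : 0 ≤ tUfitTsq J Jc := by
  unfold tUfitTsq; positivity

/-- `(tUfitT)² = tUfitTsq` on the physical domain. [cite: ColdeaEtAl2001, p. 3] -/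
theorem tUfitT_sq {J Jc : ℝ} (hJc : 0 < Jc) (h : 0 ≤ 10 * J + 3 * Jc) :
    tUfitT J Jc ^ 2 = tUfitTsq J Jc := by
  unfold tUfitT; exact sq_sqrt (tUfitTsq_nonneg hJc h)

/-- `U > 0` on the physical domain. [cite: ColdeaEtAl2001, p. 3] -/
theorem tUfitU_pos {J Jc : ℝ} (hJc : 0 < Jc) (h : 0 < 10 * J + 3 * Jc) : 0 < tUfitU J Jc := by
  unfold tUfitU; positivity

/-- `t > 0` on the physical domain. [cite: ColdeaEtAl2001, p. 3] -/
theorem tUfitT_pos {J Jc : ℝ} (hJc : 0 < Jc) (h : 0 < 10 * J + 3 * Jc) : 0 < tUfitT J Jc := by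
  unfold tUfitT tUfitTsq; exact sqrt_pos.mpr (by positivity)

/-- **Right inverse, `J_c`**: the fitted `(t, U)` reproduces the measured ring exchange.
[cite: ColdeaEtAl2001, p. 3] -/
theorem scJc_tUfit {J Jc : ℝ} (hJc : 0 < Jc) (h : 0 < 10 * J + 3 * Jc) :
    scJc (tUfitT J Jc) (tUfitU J Jc) = Jc := by
  have h4 : tUfitT J Jc ^ 4 = tUfitTsq J Jc ^ 2 := by
    rw [show (4 : ℕ) = 2 * 2 from rfl, pow_mul, tUfitT_sq hJc h.le]
  unfold scJc; rw [h4]; unfold tUfitTsq tUfitU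
  have hne : 10 * J + 3 * Jc ≠ 0 := h.ne'
  field_simp; ring

/-- **Right inverse, `J`**: the fitted `(t, U)` reproduces the measured nearest-neighbour exchange.
[cite: ColdeaEtAl2001, p. 3] -/
theorem scJ1_tUfit {J Jc : ℝ} (hJc : 0 < Jc) (h : 0 < 10 * J + 3 * Jc) :
    scJ1 (tUfitT J Jc) (tUfitU J Jc) = J := by
  have h4 : tUfitT J Jc ^ 4 = tUfitTsq J Jc ^ 2 := by
    rw [show (4 : ℕ) = 2 * 2 from rfl, pow_mul, tUfitT_sq hJc h.le]
  unfold scJ1; rw [h4, tUfitT_sq hJc h.le]; unfold tUfitTsq tUfitU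
  have hne : 10 * J + 3 * Jc ≠ 0 := h.ne'
  field_simp; ring

/-- `(U/t)² = 6 + 20J/J_c` for the fit formulas themselves. [cite: ColdeaEtAl2001, p. 3] -/
theorem tUfitU_sq_div_tUfitTsq {J Jc : ℝ} (hJc : Jc ≠ 0) (h : 10 * J + 3 * Jc ≠ 0) :
    tUfitU J Jc ^ 2 / tUfitTsq J Jc = 6 + 20 * J / Jc := by
  have h3 : (10 * J + 3 * Jc) ^ 3 ≠ 0 := pow_ne_zero 3 h
  unfold tUfitU tUfitTsq; field_simp; ring

/-- `U/t` of the fit equals `√(6 + 20J/J_c)`. [cite: ColdeaEtAl2001, p. 3] -/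
theorem tUfitU_div_tUfitT {J Jc : ℝ} (hJc : 0 < Jc) (h : 0 < 10 * J + 3 * Jc) :
    tUfitU J Jc / tUfitT J Jc = tUfitUOverT J Jc := by
  have ht := tUfitT_pos hJc h
  have hU := tUfitU_pos hJc h
  have hsq : (tUfitU J Jc / tUfitT J Jc) ^ 2 = 6 + 20 * J / Jc := by
    rw [div_pow, tUfitT_sq hJc h.le, tUfitU_sq_div_tUfitTsq hJc.ne' h.ne']
  unfold tUfitUOverT; rw [← hsq, sqrt_sq (div_pos hU ht).le]

/-! ## 3. Monotonicity: error bars on `(J, J_c)` ↦ intervals on `U`, `U/t`, `t²` -/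

/-- `U` is increasing in `J` (for `J_c > 0`, on `10J + 3J_c ≥ 0`). [cite: ColdeaEtAl2001, p. 3] -/
theorem tUfitU_mono_J {J₁ J₂ Jc : ℝ} (hJc : 0 < Jc) (h₁ : 0 ≤ 10 * J₁ + 3 * Jc) (hJ : J₁ ≤ J₂) :
    tUfitU J₁ Jc ≤ tUfitU J₂ Jc := by
  unfold tUfitU
  have hnum : (10 * J₁ + 3 * Jc) ^ 2 ≤ (10 * J₂ + 3 * Jc) ^ 2 :=
    pow_le_pow_left₀ h₁ (by linarith) 2
  exact div_le_div_of_nonneg_right hnum (by positivity)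

/-- The `J_c`-difference of `U` in factored form:
`U(J, c₁) − U(J, c₂) = (c₂ − c₁)(100J² − 9c₁c₂)/(20c₁c₂)`. [cite: ColdeaEtAl2001, p. 3] -/
theorem tUfitU_sub_tUfitU {J c₁ c₂ : ℝ} (h₁ : c₁ ≠ 0) (h₂ : c₂ ≠ 0) :
    tUfitU J c₁ - tUfitU J c₂ = (c₂ - c₁) * (100 * J ^ 2 - 9 * c₁ * c₂) / (20 * c₁ * c₂) := by
  unfold tUfitU; field_simp; ring

/-- `U` is DEcreasing in `J_c` while `3J_c ≤ 10J` (`0 < c₁ ≤ c₂`, `3c₂ ≤ 10J`).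
[cite: ColdeaEtAl2001, p. 3] -/
theorem tUfitU_anti_Jc {J c₁ c₂ : ℝ} (hc₁ : 0 < c₁) (hc : c₁ ≤ c₂) (hdom : 3 * c₂ ≤ 10 * J) :
    tUfitU J c₂ ≤ tUfitU J c₁ := by
  have hc₂ : 0 < c₂ := lt_of_lt_of_le hc₁ hc
  rw [← sub_nonneg, tUfitU_sub_tUfitU hc₁.ne' hc₂.ne']
  apply div_nonneg _ (by positivity)
  apply mul_nonneg (sub_nonneg.mpr hc)
  nlinarith [mul_le_mul (by linarith : 3 * c₁ ≤ 10 * J) hdom (by positivity) (by linarith)]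

/-- **Box → interval for `U`**: `J ∈ [J₁, J₂]`, `J_c ∈ [c₁, c₂]`, `0 < c₁`, `3c₂ ≤ 10J₁` ⟹
`U ∈ [U(J₁, c₂), U(J₂, c₁)]` (opposite corners). [cite: ColdeaEtAl2001, p. 3] -/
theorem tUfitU_mem_Icc_of_box {J₁ J₂ c₁ c₂ J Jc : ℝ} (hc₁ : 0 < c₁) (hdom : 3 * c₂ ≤ 10 * J₁)
    (hJ : J ∈ Icc J₁ J₂) (hJc : Jc ∈ Icc c₁ c₂) :
    tUfitU J Jc ∈ Icc (tUfitU J₁ c₂) (tUfitU J₂ c₁) := by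
  obtain ⟨hJ₁, hJ₂⟩ := hJ
  obtain ⟨hc₁', hc₂'⟩ := hJc
  have hJcpos : 0 < Jc := lt_of_lt_of_le hc₁ hc₁'
  constructor
  · calc tUfitU J₁ c₂ ≤ tUfitU J₁ Jc := tUfitU_anti_Jc hJcpos hc₂' hdom
      _ ≤ tUfitU J Jc := tUfitU_mono_J hJcpos (by linarith) hJ₁
  · calc tUfitU J Jc ≤ tUfitU J c₁ := tUfitU_anti_Jc hc₁ hc₁' (by linarith)
      _ ≤ tUfitU J₂ c₁ := tUfitU_mono_J hc₁ (by linarith) hJ₂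

/-- `(U/t)²` box: `6 + 20J/J_c ∈ [6 + 20J₁/c₂, 6 + 20J₂/c₁]` for `0 ≤ J₁`, `0 < c₁`.
[cite: ColdeaEtAl2001, p. 3] -/
theorem ratioSq_mem_Icc_of_box {J₁ J₂ c₁ c₂ J Jc : ℝ} (hJ₁ : 0 ≤ J₁) (hc₁ : 0 < c₁)
    (hJ : J ∈ Icc J₁ J₂) (hJc : Jc ∈ Icc c₁ c₂) :
    6 + 20 * J / Jc ∈ Icc (6 + 20 * J₁ / c₂) (6 + 20 * J₂ / c₁) := by
  obtain ⟨hJ₁', hJ₂'⟩ := hJ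
  obtain ⟨hc₁', hc₂'⟩ := hJc
  have hJcpos : 0 < Jc := lt_of_lt_of_le hc₁ hc₁'
  have hJnn : 0 ≤ J := le_trans hJ₁ hJ₁'
  constructor
  · have : 20 * J₁ / c₂ ≤ 20 * J / Jc :=
      div_le_div₀ (by positivity) (by linarith) hJcpos hc₂'
    linarith
  · have : 20 * J / Jc ≤ 20 * J₂ / c₁ :=
      div_le_div₀ (by linarith) (by linarith) hc₁ hc₁'
    linarith

/-- **Box → interval for `U/t`**: `U/t = √(6 + 20J/J_c) ∈ [√(6 + 20J₁/c₂), √(6 + 20J₂/c₁)]`.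
[cite: ColdeaEtAl2001, p. 3] -/
theorem tUfitUOverT_mem_Icc_of_box {J₁ J₂ c₁ c₂ J Jc : ℝ} (hJ₁ : 0 ≤ J₁) (hc₁ : 0 < c₁)
    (hJ : J ∈ Icc J₁ J₂) (hJc : Jc ∈ Icc c₁ c₂) :
    tUfitUOverT J Jc ∈ Icc (tUfitUOverT J₁ c₂) (tUfitUOverT J₂ c₁) := by
  obtain ⟨hlo, hhi⟩ := ratioSq_mem_Icc_of_box hJ₁ hc₁ hJ hJc
  exact ⟨sqrt_le_sqrt hlo, sqrt_le_sqrt hhi⟩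

/-- `t²` is increasing in `J` (for `J_c > 0`, on `10J + 3J_c ≥ 0`). [cite: ColdeaEtAl2001, p. 3] -/
theorem tUfitTsq_mono_J {J₁ J₂ Jc : ℝ} (hJc : 0 < Jc) (h₁ : 0 ≤ 10 * J₁ + 3 * Jc) (hJ : J₁ ≤ J₂) :
    tUfitTsq J₁ Jc ≤ tUfitTsq J₂ Jc := by
  unfold tUfitTsq
  have hnum : (10 * J₁ + 3 * Jc) ^ 3 ≤ (10 * J₂ + 3 * Jc) ^ 3 :=
    pow_le_pow_left₀ h₁ (by linarith) 3
  exact div_le_div_of_nonneg_right hnum (by positivity)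

/-- The `J_c`-difference of `t²` in factored form (`a = 10J`):
`t²(J,c₁) − t²(J,c₂) = (c₂ − c₁)(a³ − 27ac₁c₂ − 27c₁c₂(c₁ + c₂))/(800c₁c₂)`.
[cite: ColdeaEtAl2001, p. 3] -/
theorem tUfitTsq_sub_tUfitTsq {J c₁ c₂ : ℝ} (h₁ : c₁ ≠ 0) (h₂ : c₂ ≠ 0) :
    tUfitTsq J c₁ - tUfitTsq J c₂ = (c₂ - c₁) *
      ((10 * J) ^ 3 - 27 * (10 * J) * c₁ * c₂ - 27 * c₁ * c₂ * (c₁ + c₂)) / (800 * c₁ * c₂) := by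
  unfold tUfitTsq; field_simp; ring

/-- `t²` is DEcreasing in `J_c` while `3J_c ≤ 5J` (`0 < c₁ ≤ c₂`, `3c₂ ≤ 5J`).
[cite: ColdeaEtAl2001, p. 3] -/
theorem tUfitTsq_anti_Jc {J c₁ c₂ : ℝ} (hc₁ : 0 < c₁) (hc : c₁ ≤ c₂) (hdom : 3 * c₂ ≤ 5 * J) :
    tUfitTsq J c₂ ≤ tUfitTsq J c₁ := by
  have hc₂ : 0 < c₂ := lt_of_lt_of_le hc₁ hc
  rw [← sub_nonneg, tUfitTsq_sub_tUfitTsq hc₁.ne' hc₂.ne']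
  apply div_nonneg _ (by positivity)
  apply mul_nonneg (sub_nonneg.mpr hc)
  -- with `a = 10J ≥ 6c₂ ≥ 6c₁`: `c₁c₂ ≤ a²/36` and `a + c₁ + c₂ ≤ 4a/3`, so
  -- `27c₁c₂(a + c₁ + c₂) ≤ 27 (a²/36)(4a/3) = a³`.
  have ha₁ : 6 * c₁ ≤ 10 * J := by linarith
  have ha₂ : 6 * c₂ ≤ 10 * J := by linarith
  have hprod : 36 * (c₁ * c₂) ≤ (10 * J) ^ 2 := by nlinarith [mul_le_mul ha₁ ha₂ (by positivity) (by linarith)]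
  have hsum : 3 * (10 * J + c₁ + c₂) ≤ 4 * (10 * J) := by linarith
  have hJ : 0 ≤ 10 * J := by linarith
  nlinarith [mul_le_mul hprod hsum (by positivity) (by positivity), mul_nonneg hc₁.le hc₂.le]

/-- **Box → interval for `t²`**: `J ∈ [J₁, J₂]`, `J_c ∈ [c₁, c₂]`, `0 < c₁`, `3c₂ ≤ 5J₁` ⟹
`t² ∈ [t²(J₁, c₂), t²(J₂, c₁)]`. [cite: ColdeaEtAl2001, p. 3] -/
theorem tUfitTsq_mem_Icc_of_box {J₁ J₂ c₁ c₂ J Jc : ℝ} (hc₁ : 0 < c₁) (hdom : 3 * c₂ ≤ 5 * J₁)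
    (hJ : J ∈ Icc J₁ J₂) (hJc : Jc ∈ Icc c₁ c₂) :
    tUfitTsq J Jc ∈ Icc (tUfitTsq J₁ c₂) (tUfitTsq J₂ c₁) := by
  obtain ⟨hJ₁, hJ₂⟩ := hJ
  obtain ⟨hc₁', hc₂'⟩ := hJc
  have hJcpos : 0 < Jc := lt_of_lt_of_le hc₁ hc₁'
  constructor
  · calc tUfitTsq J₁ c₂ ≤ tUfitTsq J₁ Jc := tUfitTsq_anti_Jc hJcpos hc₂' hdom
      _ ≤ tUfitTsq J Jc := tUfitTsq_mono_J hJcpos (by linarith) hJ₁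
  · calc tUfitTsq J Jc ≤ tUfitTsq J c₁ := tUfitTsq_anti_Jc hc₁ hc₁' (by linarith)
      _ ≤ tUfitTsq J₂ c₁ := tUfitTsq_mono_J hc₁ (by linarith) hJ₂

/-- **Box → interval for `t`** (square roots of the `t²` corners). [cite: ColdeaEtAl2001, p. 3] -/
theorem tUfitT_mem_Icc_of_box {J₁ J₂ c₁ c₂ J Jc : ℝ} (hc₁ : 0 < c₁) (hdom : 3 * c₂ ≤ 5 * J₁)
    (hJ : J ∈ Icc J₁ J₂) (hJc : Jc ∈ Icc c₁ c₂) :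
    tUfitT J Jc ∈ Icc (tUfitT J₁ c₂) (tUfitT J₂ c₁) := by
  obtain ⟨hlo, hhi⟩ := tUfitTsq_mem_Icc_of_box hc₁ hdom hJ hJc
  exact ⟨sqrt_le_sqrt hlo, sqrt_le_sqrt hhi⟩

/-! ## 4. Worked instances against the printed tables (energies in meV; exact arithmetic) -/

/-- Coldea et al., `T = 295 K`: `J = 138.3`, `J_c = 38` ⟹ `U ∈ (2948, 2949)` meV and
`t² ∈ (110354, 110356)` meV² (`t ≈ 332.2`); printed `U = 2.9 ± 0.4 eV`, `t = 0.33 ± 0.02 eV`.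
[cite: ColdeaEtAl2001, p. 3] -/
theorem coldea2001_295K :
    2948 < tUfitU 138.3 38 ∧ tUfitU 138.3 38 < 2949 ∧
      110354 < tUfitTsq 138.3 38 ∧ tUfitTsq 138.3 38 < 110356 := by
  unfold tUfitU tUfitTsq; norm_num

/-- Coldea et al., `T = 10 K`: `J = 146.3`, `J_c = 61` ⟹ `U ∈ (2220, 2221)` meV and
`t² ∈ (91383, 91385)` meV² (`t ≈ 302.3`); printed `U = 2.2 ± 0.4 eV`, `t = 0.30 ± 0.02 eV`.
[cite: ColdeaEtAl2001, p. 3] -/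
theorem coldea2001_10K :
    2220 < tUfitU 146.3 61 ∧ tUfitU 146.3 61 < 2221 ∧
      91383 < tUfitTsq 146.3 61 ∧ tUfitTsq 146.3 61 < 91385 := by
  unfold tUfitU tUfitTsq; norm_num

/-- Headings et al. (10 K): `J = 143`, `J_c = 58` ⟹ `U ∈ (2217, 2218)` meV, `U/t ∈ (7.43, 7.44)`,
and the printed `J′ = J″ = 2.9` meV IS `J_c/20`. [cite: HeadingsEtAl2010, p. 3] -/
theorem headings2010 :
    2217 < tUfitU 143 58 ∧ tUfitU 143 58 < 2218 ∧
      7.43 < tUfitUOverT 143 58 ∧ tUfitUOverT 143 58 < 7.44 ∧ (58 : ℝ) / 20 = 2.9 := by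
  refine ⟨by unfold tUfitU; norm_num, by unfold tUfitU; norm_num, ?_, ?_, by norm_num⟩
  · unfold tUfitUOverT
    exact (lt_sqrt (by norm_num)).mpr (by norm_num)
  · unfold tUfitUOverT
    exact (sqrt_lt' (by norm_num)).mpr (by norm_num)

/-- Peng et al., Table 1, La₂CuO₄ row: `J = 140.2`, `J_c = 40.5` ⟹ `U ∈ (2865, 2866)`,
`t² ∈ (109139, 109141)` (`t ≈ 330.4`); printed `U = 2865`, `t = 330.4` meV.
[cite: PengEtAl2017, Table 1] -/
theorem peng2017_LCO :
    2865 < tUfitU 140.2 40.5 ∧ tUfitU 140.2 40.5 < 2866 ∧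
      109139 < tUfitTsq 140.2 40.5 ∧ tUfitTsq 140.2 40.5 < 109141 := by
  unfold tUfitU tUfitTsq; norm_num

/-- Peng et al., Table 1, CaCuO₂ row: `J = 182.3`, `J_c = 205.6` ⟹ `U ∈ (1447, 1448)`,
`t² ∈ (88297, 88300)` (`t ≈ 297.2`); printed `U = 1447`, `t = 297.1` meV, `U/t = 4.88`.
[cite: PengEtAl2017, Table 1] -/
theorem peng2017_CCO :
    1447 < tUfitU 182.3 205.6 ∧ tUfitU 182.3 205.6 < 1448 ∧
      88297 < tUfitTsq 182.3 205.6 ∧ tUfitTsq 182.3 205.6 < 88300 := by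
  unfold tUfitU tUfitTsq; norm_num

/-- **Independent error-bar propagation, Coldea 295 K**: `J ∈ [134.3, 142.3]`, `J_c ∈ [30, 46]`
⟹ `U ∈ [U(134.3, 46), U(142.3, 30)] ⊂ (2384, 3816)` meV (printed least-squares bar: `2.9 ± 0.4 eV`).
[cite: ColdeaEtAl2001, p. 3] -/
theorem coldea2001_295K_box {J Jc : ℝ} (hJ : J ∈ Icc 134.3 142.3) (hJc : Jc ∈ Icc 30 46) :
    tUfitU J Jc ∈ Icc (tUfitU 134.3 46) (tUfitU 142.3 30) ∧
      2384 < tUfitU 134.3 46 ∧ tUfitU 142.3 30 < 3816 :=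
  ⟨tUfitU_mem_Icc_of_box (by norm_num) (by norm_num) hJ hJc,
    by unfold tUfitU; norm_num, by unfold tUfitU; norm_num⟩

/-- **Independent error-bar propagation, Coldea 10 K**: `J ∈ [142.3, 150.3]`, `J_c ∈ [53, 69]`
⟹ `U ∈ [U(142.3, 69), U(150.3, 53)] ⊂ (1925, 2606)` meV (printed least-squares bar: `2.2 ± 0.4 eV`).
[cite: ColdeaEtAl2001, p. 3] -/
theorem coldea2001_10K_box {J Jc : ℝ} (hJ : J ∈ Icc 142.3 150.3) (hJc : Jc ∈ Icc 53 69) :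
    tUfitU J Jc ∈ Icc (tUfitU 142.3 69) (tUfitU 150.3 53) ∧
      1925 < tUfitU 142.3 69 ∧ tUfitU 150.3 53 < 2606 :=
  ⟨tUfitU_mem_Icc_of_box (by norm_num) (by norm_num) hJ hJc,
    by unfold tUfitU; norm_num, by unfold tUfitU; norm_num⟩

end

end Literature.MathematicalPhysics.QuantumLattice
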